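import Mathlib
import Summits.NavierStokesRegularity.NavierStokesRegularity.Theorems.SubOnsagerCeilingGapFamilyKernel
import HarnessLib

/-!
# Parametric face family: the certificate → `hFace` bridge with an ARBITRARY strictness margin `−δ`
(helper file for crux stmt-NavierStokesRegularity-27057 `SubOnsagerCeiling.ForwardTailCeilingKP`, `--supports … --as helper`;
LEAD SOC g12, line «kp-shell-barrier», parametric route)

`GapFamily.inertial_of_cert` (p704851) reads kernel certificates of the inertial face conditions with the fixed bound `−1/256`.
Below `b ≈ 1.45` the margins of the cubic floors of the d45 topology are structurally thin (LEAD g12 census v15: at `κ ≈ 0.46`,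
which the caps force as `p = b^(197/200)` falls, the floor `x_{i+1} ≥ κx_i³ − ε` keeps an inertial margin of order `10⁻³` only,
near `x_i ≈ 1/2`, `x_{i−1} ≈ 49/50`), so certificates with the bound `−1/256` cost thousands of leaves or do not exist while
the condition itself (`< 0`) holds. `inertial_of_cert_bnd` is the same bridge for any rational `δ > 0` (bound `−δ`), by the
general kernel lemma `KernelFaceAffine.eval_lt_zero_of_kdCheckAff_subst` (p699455). HONEST FRAMING: MODEL-lattice tooling
(route SubOnsagerCeiling, TL-M2Break); nothing here bears on Navier–Stokes regularity; 27057 stays OPEN.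
[cite: FigueiredoStolfi2004, §3] [cite: Moore1966, §4.4]
-/

noncomputable section

-- the sub-problem namespace `NavierStokesRegularity.NavierStokesRegularity` is the tree's layout (D-0017)
set_option linter.dupNamespace false

namespace Summit.NavierStokesRegularity.NavierStokesRegularity.Theorems.VirtualFloor.GapFamily

open Literature.Analysis.ValidatedNumerics KernelFaceMul KernelFaceAffine
open Summit.NavierStokesRegularity.NavierStokesRegularity.Theorems.VirtualFloor
open Summit.NavierStokesRegularity.NavierStokesRegularity.Theorems.VirtualFloor.GapRung (Ix pt pt_mem_box9 allIx sElim)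

/-- **Inertial face condition from a kernel certificate with bound `−δ`, any rational `δ > 0`** (parametric family):
an accepted certificate on a box, box membership of the point, the three windows in `Ω` and the face active give the
REAL inertial conjunct of `hFace` (`< 0`). [cite: FigueiredoStolfi2004, §3] -/
theorem inertial_of_cert_bnd {θ : Params} (ha0 : θ.a0 ≠ 0) {k : Ix} {t : KdCert LeafMul} {B : Box} {δ : ℚ} (hδ : 0 < δ)
    (hcert : t.check (leafCheckAff (substVar (sElim k) (qElim θ k) (eBase θ k))
      ((gsBase θ).map (substVar (sElim k) (qElim θ k)) ++ [qElim θ k, .sub (.const (49 / 50)) (qElim θ k)]) (-δ)) B = true)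
    {x : Fin 4 → ℝ} {v z L p b2 : ℝ} (hmem : Box.mem B (pt x v z L p b2))
    (h0 : ∀ i, 0 ≤ x i) (hc : ∀ i, x i ≤ (49 / 50 : ℝ))
    (hX : ∀ j, face θ j x ≤ 0) (hLo : ∀ j, face θ j (vec4 v (x 0) (x 1) (x 2)) ≤ 0)
    (hUp : ∀ j, face θ j (vec4 (x 1) (x 2) (x 3) z) ≤ 0) (hk : face θ k x = 0) :
    faceGrad θ k 0 x * (v ^ 2 - p * x 0 * x 1) + faceGrad θ k 1 x * (L * (x 0 ^ 2 - p * x 1 * x 2)) +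
      faceGrad θ k 2 x * (L ^ 2 * (x 1 ^ 2 - p * x 2 * x 3)) + faceGrad θ k 3 x * (L ^ 3 * (x 2 ^ 2 - p * x 3 * z)) < 0 := by
  rw [← eval_eBase θ x v z L p b2 k]
  exact eval_lt_zero_of_kdCheckAff_subst hδ hcert _ hmem (pt_sElim_eq θ x v z L p b2 ha0 k hk)
    (gsBase_nonneg θ x v z L p b2 hX hLo hUp) (extra_nonneg θ x v z L p b2 ha0 k hk h0 hc)

end Summit.NavierStokesRegularity.NavierStokesRegularity.Theorems.VirtualFloor.GapFamily

end
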